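import Summits.RiemannHypothesis.RiemannHypothesis.Theorems.WindowTraceArch.Negative.UnitMass
import Literature.NumberTheory.LFunctions.WeilGroundState
import Literature.NumberTheory.LFunctions.WeilGroundStateRealZerosProofs
import HarnessLib

/-!
# `WindowStep`, line `conjugate-point` — stub `stub_groundStateSampling` (the lever)

Support for the crux `stmt-RiemannHypothesis-14659`
(`Summit.RiemannHypothesis.RiemannHypothesis.Theses.SpectralTrace.WindowStep`), line
`conjugate-point`. A real family `γ` reproducing `W = weilFunctional` on the Weil tests supported
in `[-2a, 2a]` samples every ground state `u` of the window `a` from below: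
`Σ_i ‖û(1/2 + iγ_i)‖² ≤ ε(a) = weilGroundEnergy a` (RH-free).

Proof. Let `g_n` be the `L²`-normalised minimising tests of `IsWeilGroundState a u`. By the unit
mass inequality at level `2a` for tests on `[-a, a]` (`sum_norm_sq_le_of_windowTrace`) every
finite partial sum `∑_{i ∈ F} ‖ĝ_n(1/2+iγ_i)‖²` is `≤ Re Q(g_n)`; `ĝ_n(s) → û(s)` pointwise
(`ConnesVanSuijlekom.tendsto_weilMellin`) and `Re Q(g_n) → ε(a)`, so every finite partial sum of
`‖û(1/2+iγ_i)‖²` is `≤ ε(a)`; the terms are nonnegative, whence summability and the bound on the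
sum (`summable_of_sum_le`, `Real.tsum_le_of_sum_le`).
-/

set_option linter.dupNamespace false

noncomputable section

open Complex Set Filter MeasureTheory
open scoped Topology

namespace Summit.RiemannHypothesis.RiemannHypothesis.Theorems.SpectralTraceWindowStep

open Literature.NumberTheory.LFunctions
open Summit.RiemannHypothesis.RiemannHypothesis.Theorems.WindowTraceArch.Negative

/-- **Finite sampling bound.** For a real family reproducing `W` on the Weil tests of `[-2a, 2a]`
and a ground state `u` of the window `a`, every finite partial sum of `‖û(1/2+iγ_i)‖²` is
`≤ ε(a)`: pass to the limit along the minimising tests in the unit-mass inequality. [folklore] -/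
theorem sum_norm_sq_weilMellin_groundState_le {a : ℝ} {ι : Type*} {γ : ι → ℝ}
    (h : ∀ g : ℝ → ℂ, IsWeilTest g → tsupport g ⊆ Icc (-(2 * a)) (2 * a) →
      HasSum (fun i => weilMellin g (1 / 2 + (γ i : ℂ) * I)) (weilFunctional g))
    {u : ℝ → ℂ} (hu : IsWeilGroundState a u) (F : Finset ι) :
    ∑ i ∈ F, ‖weilMellin u (1 / 2 + (γ i : ℂ) * I)‖ ^ 2 ≤ weilGroundEnergy a := by
  obtain ⟨-, g, hg, hQ, hL2⟩ := id hu
  -- (1) the unit-mass inequality along the minimising sequence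
  have h1 : ∀ n, ∑ i ∈ F, ‖weilMellin (g n) (1 / 2 + (γ i : ℂ) * I)‖ ^ 2 ≤
      (weilQuadratic (g n)).re := fun n => by
    refine sum_norm_sq_le_of_windowTrace h (hg n).1 ?_ F
    rw [show (2 * a / 2 : ℝ) = a by ring]
    exact (hg n).2.1
  -- (2) pointwise convergence of the transforms on the critical line, summed over `F`
  have h2 : Tendsto (fun n => ∑ i ∈ F, ‖weilMellin (g n) (1 / 2 + (γ i : ℂ) * I)‖ ^ 2) atTop
      (𝓝 (∑ i ∈ F, ‖weilMellin u (1 / 2 + (γ i : ℂ) * I)‖ ^ 2)) := by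
    refine tendsto_finsetSum F fun i _ => ?_
    exact ((ConnesVanSuijlekom.tendsto_weilMellin hu (fun m => ⟨(hg m).1, (hg m).2.1⟩) hL2
      (1 / 2 + (γ i : ℂ) * I)).norm).pow 2
  -- (3) `Re Q(g_n) → ε(a)`; pass to the limit
  exact le_of_tendsto_of_tendsto' h2 hQ h1

/-- **stub_groundStateSampling (RH-free; the lever of the line `conjugate-point`).** A real family
reproducing `W` on the Weil tests of `[-2a, 2a]` samples every ground state of the window `a` from
below: `Σ_i ‖û(1/2+iγ_i)‖²` is summable and `≤ ε(a) = weilGroundEnergy a`. [folklore] -/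
theorem stub_groundStateSampling :
    ∀ a : ℝ, 0 < a → ∀ (ι : Type) (γ : ι → ℝ),
      (∀ g : ℝ → ℂ, Literature.NumberTheory.LFunctions.IsWeilTest g →
        tsupport g ⊆ Set.Icc (-(2 * a)) (2 * a) →
          HasSum (fun i => Literature.NumberTheory.LFunctions.weilMellin g (1 / 2 + (γ i : ℂ) * Complex.I))
            (Literature.NumberTheory.LFunctions.weilFunctional g)) →
      ∀ u : ℝ → ℂ, Literature.NumberTheory.LFunctions.IsWeilGroundState a u →
        Summable (fun i => ‖Literature.NumberTheory.LFunctions.weilMellin u (1 / 2 + (γ i : ℂ) * Complex.I)‖ ^ 2) ∧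
          ∑' i, ‖Literature.NumberTheory.LFunctions.weilMellin u (1 / 2 + (γ i : ℂ) * Complex.I)‖ ^ 2 ≤
            Literature.NumberTheory.LFunctions.weilGroundEnergy a := by
  intro a _ ι γ h u hu
  have hnn : 0 ≤ fun i => ‖weilMellin u (1 / 2 + (γ i : ℂ) * Complex.I)‖ ^ 2 :=
    fun i => by positivity
  have hF := sum_norm_sq_weilMellin_groundState_le h hu
  exact ⟨summable_of_sum_le hnn hF, Real.tsum_le_of_sum_le hnn hF⟩

end Summit.RiemannHypothesis.RiemannHypothesis.Theorems.SpectralTraceWindowStep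

end
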